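import Mathlib.RingTheory.Polynomial.Resultant.Basic
import Literature.NumberTheory.DiophantineGeometry.PlaneSectionBookkeepingProofs
import Literature.NumberTheory.DiophantineGeometry.BertiniHomogenizationProofs
import Literature.RingTheory.MvPolynomial.KaltofenNoetherFormsGeneric
import Literature.RingTheory.MvPolynomial.KaltofenNoetherFormsSpecProofs
import Literature.RingTheory.MvPolynomial.KaltofenNoetherFormsLemma7Proofs
import Literature.RingTheory.MvPolynomial.KaltofenNoetherFormsLemma3Proofs
import HarnessLib

/-!
# Towards Kaltofen's Theorem 7 (effective Noether forms): proofs — the logic of §5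

Sibling proof file of `KaltofenNoetherForms.lean` (E. Kaltofen, J. Comput. System Sci. 50
(1995) 274–295, §5, proof of Thm. 7, p. 25: "We first argue that (34) are Noether
irreducibility forms …"). Kaltofen's argument has three cases according to which of the sets
`S₁` (top coefficients), `S₂` (coefficients of the generic discriminant `ρ̄`), `S₃`
(coefficients of the cleared evaluations `λ^D Δ'` of the bivariate forms) vanishes on the
coefficients of a given `f`. This file proves the case analysis RELATIVE TO THE BIVARIATE ENGINE
(Kaltofen's Thm. 4 together with the correctness of the algorithm Absolute Irreducibility Test,
§2–3), which enters as an explicit hypothesis `hengine` (no named fact is introduced):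

* `vanishing_iff_of_engine` — for `f` of degree `≤ d` over a field `K`:
  (all of `S₁` vanish) ∨ (`spec ρ̄ = 0`) ∨ (all `spec (λ^D Δ'_s) = 0`) `↔`
  (`deg f < d` ∨ `f` is not absolutely irreducible).

Inputs: Lemma 3 (`resultant_genericLine_derivative_ne_zero`, case `S₂`), Lemma 7
(`irreducible_planeSection_of_algebraicIndependent`, case `S₃`), the specialisation lemmas of
`KaltofenNoetherFormsSpecProofs`, and the plane-section bookkeeping of the tree
(`PlaneSectionBookkeepingProofs`). The field of the engine is `F = K(params)`
(`FractionRing`), its algebraic closure `Ω` hosts the algebraically independent parameters.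

## References

* E. Kaltofen, J. Comput. System Sci. 50 (1995) 274–295, §5 proof of Thm. 7. [Kaltofen1995]
-/

noncomputable section

open MvPolynomial
open scoped Polynomial

universe u

namespace Literature.RingTheory.MvPolynomial

open Literature.NumberTheory.DiophantineGeometry

namespace KaltofenGeneric

/-! ### Plane sections with constant parameters: shape -/

section Shape

variable {A : Type*} [CommRing A] {n : ℕ}

/-- `f(a + bx + cy)` in the affine shape `f(b·x + (a + c y))` of `PlaneSectionBookkeepingProofs`.
[folklore] -/
theorem planeConst_eq_affine (a b c : Fin n → A) (p : MvPolynomial (Fin n) A) :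
    MvPolynomial.aeval (fun i ↦
      (Polynomial.C (Polynomial.C (a i)) + Polynomial.C (Polynomial.C (b i)) * Polynomial.X +
        Polynomial.C (Polynomial.C (c i) * Polynomial.X) : Polynomial (Polynomial A))) p =
    MvPolynomial.aeval (fun i ↦ Polynomial.C (Polynomial.C (b i)) * Polynomial.X +
      Polynomial.C (Polynomial.C (a i) + Polynomial.C (c i) * Polynomial.X)) p := by
  have hθ : (fun i ↦
      (Polynomial.C (Polynomial.C (a i)) + Polynomial.C (Polynomial.C (b i)) * Polynomial.X +
        Polynomial.C (Polynomial.C (c i) * Polynomial.X) : Polynomial (Polynomial A))) =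
      fun i ↦ Polynomial.C (Polynomial.C (b i)) * Polynomial.X +
        Polynomial.C (Polynomial.C (a i) + Polynomial.C (c i) * Polynomial.X) := by
    funext i
    simp only [map_add, map_mul]
    ring
  rw [hθ]

/-- **Total degree `≤ deg f`** of the plane section with constant parameters. [folklore] -/
theorem coeff_coeff_planeConst_eq_zero (a b c : Fin n → A) (p : MvPolynomial (Fin n) A) :
    ∀ k j, p.totalDegree < j + k → ((MvPolynomial.aeval (fun i ↦
      (Polynomial.C (Polynomial.C (a i)) + Polynomial.C (Polynomial.C (b i)) * Polynomial.X +
        Polynomial.C (Polynomial.C (c i) * Polynomial.X) : Polynomial (Polynomial A))) p).coeff k).coeff j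
        = 0 := by
  rw [planeConst_eq_affine]
  refine coeff_coeff_aeval_affine_eq_zero p b (fun i => Polynomial.C (a i) + Polynomial.C (c i) * Polynomial.X)
    fun i => ?_
  refine (Polynomial.natDegree_add_le _ _).trans (max_le ?_ ?_)
  · rw [Polynomial.natDegree_C]; exact Nat.zero_le _
  · exact (Polynomial.natDegree_C_mul_le _ _).trans Polynomial.natDegree_X_le

/-- **`x`-degree `≤ deg f`.** [folklore] -/
theorem natDegree_planeConst_le (a b c : Fin n → A) (p : MvPolynomial (Fin n) A) :
    (MvPolynomial.aeval (fun i ↦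
      (Polynomial.C (Polynomial.C (a i)) + Polynomial.C (Polynomial.C (b i)) * Polynomial.X +
        Polynomial.C (Polynomial.C (c i) * Polynomial.X) : Polynomial (Polynomial A))) p).natDegree ≤
      p.totalDegree := by
  rw [Polynomial.natDegree_le_iff_coeff_eq_zero]
  intro k hk
  ext j
  rw [Polynomial.coeff_zero]
  exact coeff_coeff_planeConst_eq_zero a b c p k j (by omega)

/-- **Top `x`-coefficient** `= f_δ(b)`. [folklore] -/
theorem coeff_planeConst_totalDegree (a b c : Fin n → A) (p : MvPolynomial (Fin n) A) :
    (MvPolynomial.aeval (fun i ↦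
      (Polynomial.C (Polynomial.C (a i)) + Polynomial.C (Polynomial.C (b i)) * Polynomial.X +
        Polynomial.C (Polynomial.C (c i) * Polynomial.X) : Polynomial (Polynomial A))) p).coeff p.totalDegree
      = Polynomial.C (MvPolynomial.eval b (homogeneousComponent p.totalDegree p)) := by
  rw [planeConst_eq_affine]
  exact coeff_aeval_affine_totalDegree p b _

/-- **Setting `y = 0`** gives the line section `f(a + bx)`. [folklore] -/
theorem map_evalRingHom_zero_planeConst (a b c : Fin n → A) (p : MvPolynomial (Fin n) A) :
    (MvPolynomial.aeval (fun i ↦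
      (Polynomial.C (Polynomial.C (a i)) + Polynomial.C (Polynomial.C (b i)) * Polynomial.X +
        Polynomial.C (Polynomial.C (c i) * Polynomial.X) : Polynomial (Polynomial A))) p).map
        (Polynomial.evalRingHom 0) =
      MvPolynomial.aeval (fun i ↦ Polynomial.C (a i) + Polynomial.C (b i) * Polynomial.X : Fin n → A[X]) p := by
  have key : (Polynomial.mapRingHom (Polynomial.evalRingHom (0 : A))).comp
      (MvPolynomial.aeval (R := A) (fun i ↦
        (Polynomial.C (Polynomial.C (a i)) + Polynomial.C (Polynomial.C (b i)) * Polynomial.X +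
          Polynomial.C (Polynomial.C (c i) * Polynomial.X) : Polynomial (Polynomial A)))).toRingHom =
      (MvPolynomial.aeval (R := A) (fun i ↦ Polynomial.C (a i) + Polynomial.C (b i) * Polynomial.X :
        Fin n → A[X])).toRingHom := by
    refine MvPolynomial.ringHom_ext (fun r => ?_) (fun i => ?_)
    · simp only [RingHom.coe_comp, Function.comp_apply, AlgHom.toRingHom_eq_coe, RingHom.coe_coe,
        MvPolynomial.algHom_C, Polynomial.algebraMap_apply, Polynomial.coe_mapRingHom, Polynomial.map_C,
        Polynomial.coe_evalRingHom, Polynomial.eval_C, Algebra.algebraMap_self_apply]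
    · simp only [RingHom.coe_comp, Function.comp_apply, AlgHom.toRingHom_eq_coe, RingHom.coe_coe,
        MvPolynomial.aeval_X, Polynomial.coe_mapRingHom, Polynomial.map_add, Polynomial.map_mul,
        Polynomial.map_C, Polynomial.map_X, Polynomial.coe_evalRingHom, Polynomial.eval_C,
        Polynomial.eval_mul, Polynomial.eval_X, mul_zero, map_zero, add_zero]
  exact DFunLike.congr_fun key p

/-- Pushing the constant-parameter section along a ring map. [folklore] -/
theorem map_mapRingHom_planeConst {B : Type*} [CommRing B] (φ : A →+* B) (a b c : Fin n → A)
    (p : MvPolynomial (Fin n) A) :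
    (MvPolynomial.aeval (fun i ↦
      (Polynomial.C (Polynomial.C (a i)) + Polynomial.C (Polynomial.C (b i)) * Polynomial.X +
        Polynomial.C (Polynomial.C (c i) * Polynomial.X) : Polynomial (Polynomial A))) p).map
        (Polynomial.mapRingHom φ) =
      MvPolynomial.aeval (fun i ↦
        (Polynomial.C (Polynomial.C (φ (a i))) + Polynomial.C (Polynomial.C (φ (b i))) * Polynomial.X +
          Polynomial.C (Polynomial.C (φ (c i)) * Polynomial.X) : Polynomial (Polynomial B)))
        (MvPolynomial.map φ p) := by
  have key : (Polynomial.mapRingHom (Polynomial.mapRingHom φ)).comp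
      (MvPolynomial.aeval (R := A) (fun i ↦
        (Polynomial.C (Polynomial.C (a i)) + Polynomial.C (Polynomial.C (b i)) * Polynomial.X +
          Polynomial.C (Polynomial.C (c i) * Polynomial.X) : Polynomial (Polynomial A)))).toRingHom =
      (MvPolynomial.aeval (R := B) (fun i ↦
        (Polynomial.C (Polynomial.C (φ (a i))) + Polynomial.C (Polynomial.C (φ (b i))) * Polynomial.X +
          Polynomial.C (Polynomial.C (φ (c i)) * Polynomial.X) : Polynomial (Polynomial B)))).toRingHom.comp
        (MvPolynomial.map φ) := by
    refine MvPolynomial.ringHom_ext (fun r => ?_) (fun i => ?_)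
    · simp only [RingHom.coe_comp, Function.comp_apply, AlgHom.toRingHom_eq_coe, RingHom.coe_coe,
        MvPolynomial.algHom_C, Polynomial.algebraMap_apply, Polynomial.coe_mapRingHom, Polynomial.map_C,
        MvPolynomial.map_C, Algebra.algebraMap_self_apply]
    · simp only [RingHom.coe_comp, Function.comp_apply, AlgHom.toRingHom_eq_coe, RingHom.coe_coe,
        MvPolynomial.aeval_X, Polynomial.coe_mapRingHom, Polynomial.map_add, Polynomial.map_mul,
        Polynomial.map_C, Polynomial.map_X, MvPolynomial.map_X]
  exact DFunLike.congr_fun key p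

/-- A plane section of a reducible polynomial of exact `x`-degree is reducible: if `p = a b`
over a field with `a, b` of positive degree and the section of `p` has `x`-degree `deg p`, then
the section is a product of two factors of positive `x`-degree. [cite: Kaltofen1995, §5 proof of Lemma 7 ("Clearly, if f factors over K̄, so does φ₂")] -/
theorem not_irreducible_planeConst_of_mul {L : Type*} [Field L] (a b c : Fin n → L)
    {p p₁ p₂ : MvPolynomial (Fin n) L} (hp : p = p₁ * p₂) (h₁ : 0 < p₁.totalDegree) (h₂ : 0 < p₂.totalDegree)
    (hdeg : (MvPolynomial.aeval (fun i ↦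
      (Polynomial.C (Polynomial.C (a i)) + Polynomial.C (Polynomial.C (b i)) * Polynomial.X +
        Polynomial.C (Polynomial.C (c i) * Polynomial.X) : Polynomial (Polynomial L))) p).natDegree =
        p.totalDegree) :
    ¬ Irreducible (MvPolynomial.aeval (fun i ↦
      (Polynomial.C (Polynomial.C (a i)) + Polynomial.C (Polynomial.C (b i)) * Polynomial.X +
        Polynomial.C (Polynomial.C (c i) * Polynomial.X) : Polynomial (Polynomial L))) p) := by
  set θ : Fin n → Polynomial (Polynomial L) := fun i ↦
      (Polynomial.C (Polynomial.C (a i)) + Polynomial.C (Polynomial.C (b i)) * Polynomial.X +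
        Polynomial.C (Polynomial.C (c i) * Polynomial.X)) with hθ
  have h₁0 : p₁ ≠ 0 := fun h => by rw [h, totalDegree_zero] at h₁; exact lt_irrefl _ h₁
  have h₂0 : p₂ ≠ 0 := fun h => by rw [h, totalDegree_zero] at h₂; exact lt_irrefl _ h₂
  have hsum : p.totalDegree = p₁.totalDegree + p₂.totalDegree := by
    rw [hp, totalDegree_mul_of_isDomain h₁0 h₂0]
  have hmul : MvPolynomial.aeval θ p = MvPolynomial.aeval θ p₁ * MvPolynomial.aeval θ p₂ := by
    rw [hp, map_mul]
  have hA0 : MvPolynomial.aeval θ p₁ ≠ 0 := by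
    intro h0; rw [h0, zero_mul] at hmul
    rw [hmul, Polynomial.natDegree_zero] at hdeg; omega
  have hB0 : MvPolynomial.aeval θ p₂ ≠ 0 := by
    intro h0; rw [h0, mul_zero] at hmul
    rw [hmul, Polynomial.natDegree_zero] at hdeg; omega
  have hdA : (MvPolynomial.aeval θ p₁).natDegree ≤ p₁.totalDegree := natDegree_planeConst_le a b c p₁
  have hdB : (MvPolynomial.aeval θ p₂).natDegree ≤ p₂.totalDegree := natDegree_planeConst_le a b c p₂
  have hdAB : (MvPolynomial.aeval θ p).natDegree =
      (MvPolynomial.aeval θ p₁).natDegree + (MvPolynomial.aeval θ p₂).natDegree := by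
    rw [hmul, Polynomial.natDegree_mul hA0 hB0]
  have hdA' : 0 < (MvPolynomial.aeval θ p₁).natDegree := by omega
  have hdB' : 0 < (MvPolynomial.aeval θ p₂).natDegree := by omega
  intro hirr
  rcases hirr.isUnit_or_isUnit hmul with hu | hu
  · have := Polynomial.natDegree_eq_zero_of_isUnit hu; omega
  · have := Polynomial.natDegree_eq_zero_of_isUnit hu; omega

end Shape

/-! ### The specialised plane section over `K[params]` -/

section Specialised

variable {K : Type u} [Field K] {n d : ℕ}

/-- The coefficients of the specialised plane section are the specialised `N_b`. [folklore] -/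
theorem coeff_coeff_planeK (f : MvPolynomial (Fin n) K) (hf : f.totalDegree ≤ d) (i j : ℕ) :
    ((MvPolynomial.aeval (fun i ↦
      (Polynomial.C (Polynomial.C (X (Sum.inr (Sum.inl i)))) +
        Polynomial.C (Polynomial.C (X (Sum.inr (Sum.inr i)))) * Polynomial.X +
        Polynomial.C (Polynomial.C (X (Sum.inl i)) * Polynomial.X) :
          Polynomial (Polynomial (MvPolynomial (Params n) K)))) f).coeff i).coeff j =
      spec (fun e => f.coeff e) (bivCoeff n d (i, j)) := by
  rw [← map_spec_planeGen f hf, Polynomial.coeff_map, Polynomial.coe_mapRingHom, Polynomial.coeff_map]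
  rfl

/-- `λ` specialised is nonzero exactly when `f` has degree `d` (for `f ≠ 0` of degree `≤ d` we
record the direction needed: degree `d` forces `spec λ ≠ 0`). [cite: Kaltofen1995, §5 proof of Thm. 7 ("f has degree d, hence l ≠ 0")] -/
theorem spec_lam_ne_zero {f : MvPolynomial (Fin n) K} (hf0 : f ≠ 0) (hfd : f.totalDegree = d) :
    spec (fun e => f.coeff e) (lam n d) ≠ 0 := by
  rw [spec_lam]
  have heq : (MvPolynomial.aeval (fun i : Fin n => (X (Sum.inr (Sum.inr i)) : MvPolynomial (Params n) K)) :
      MvPolynomial (Fin n) K →ₐ[K] MvPolynomial (Params n) K) =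
      MvPolynomial.rename (fun i : Fin n => (Sum.inr (Sum.inr i) : Params n)) := by
    refine MvPolynomial.algHom_ext fun i => ?_
    rw [MvPolynomial.aeval_X, MvPolynomial.rename_X]
  have hinj : Function.Injective (MvPolynomial.rename (fun i : Fin n => (Sum.inr (Sum.inr i) : Params n)) :
      MvPolynomial (Fin n) K → MvPolynomial (Params n) K) :=
    rename_injective _ (Sum.inr_injective.comp Sum.inr_injective)
  have h := homogeneousComponent_totalDegree_ne_zero hf0
  rw [hfd] at h
  rw [heq]
  intro h0
  exact h (hinj (by rw [map_zero]; exact h0))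


/-! ### Case `S₃`: the bivariate engine and Lemma 7 -/

/-- **Kaltofen's third case, relative to the bivariate engine.** Let `f` have degree exactly
`d ≥ 2` and suppose the discriminant of its generic line section does not vanish
(`spec ρ̄ ≠ 0`, i.e. not case `S₂`). Assume the engine `hengine`: integer bivariate forms `Δ_s`
of degree `≤ D` which, for every monic `ψ ∈ F[y][x]` of `x`-degree `d`, total degree `≤ d` and
with `ψ(x, 0)` of non-vanishing discriminant, all vanish at the coefficients of `ψ` iff `ψ` is
reducible over `F̄` (Kaltofen's Thm. 4 + the algorithm Absolute Irreducibility Test). Then all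
cleared evaluations `λ^D Δ'_s` vanish at the coefficients of `f` iff `f` is not absolutely
irreducible. (The engine is applied over `F = K(params)` to `ψ₂ = φ₂/λ`; "`ψ₂` will be certified
absolutely irreducible over `L(z's)`, which by Lemma 7 establishes absolute irreducibility for
`f`" and conversely.) [cite: Kaltofen1995, §5 proof of Thm. 7 (third case)] -/
theorem spec_clearedEval_eq_zero_iff (hd : 2 ≤ d) {ι : Type*} (Δ : ι → MvPolynomial (ℕ × ℕ) ℤ)
    {D : ℕ} (hΔ : ∀ s, (Δ s).totalDegree ≤ D)
    (hengine : ∀ (F : Type u) [Field F] (ψ : Polynomial (Polynomial F)),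
      ψ.Monic → ψ.natDegree = d → (∀ i j, d < i + j → (ψ.coeff i).coeff j = 0) →
      Polynomial.resultant (ψ.map (Polynomial.evalRingHom 0))
        (Polynomial.derivative (ψ.map (Polynomial.evalRingHom 0))) d (d - 1) ≠ 0 →
      ((∀ s, MvPolynomial.eval₂ (Int.castRingHom F) (fun b : ℕ × ℕ => (ψ.coeff b.1).coeff b.2) (Δ s) = 0) ↔
        ¬ Irreducible (ψ.map (Polynomial.mapRingHom (algebraMap F (AlgebraicClosure F))))))
    (f : MvPolynomial (Fin n) K) (hfd : f.totalDegree = d)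
    (hρ : spec (fun e => f.coeff e) (rhoBar n d) ≠ 0) :
    (∀ s, spec (fun e => f.coeff e) (clearedEval n d D (Δ s)) = 0) ↔ ¬ IsAbsIrreducible f := by
  classical
  have hf : f.totalDegree ≤ d := hfd.le
  have hd0 : 0 < d := by omega
  have hf0 : f ≠ 0 := by rintro rfl; rw [totalDegree_zero] at hfd; omega
  -- the ring maps `𝔼 = K[params] → 𝔽 = K(params) → Ω̄`
  set ιF : MvPolynomial (Params n) K →+* FractionRing (MvPolynomial (Params n) K) :=
    algebraMap _ _ with hιF
  set ιΩ : MvPolynomial (Params n) K →+* AlgebraicClosure (FractionRing (MvPolynomial (Params n) K)) :=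
    algebraMap _ _ with hιΩ
  set jΩ : FractionRing (MvPolynomial (Params n) K) →+*
      AlgebraicClosure (FractionRing (MvPolynomial (Params n) K)) := algebraMap _ _ with hjΩ
  have hιF_inj : Function.Injective ιF := IsFractionRing.injective (MvPolynomial (Params n) K) _
  have hιΩ_eq : ιΩ = jΩ.comp ιF := IsScalarTower.algebraMap_eq _ _ _
  have hιΩ_inj : Function.Injective ιΩ := by rw [hιΩ_eq]; exact jΩ.injective.comp hιF_inj
  have hKΩ : algebraMap K (AlgebraicClosure (FractionRing (MvPolynomial (Params n) K))) =
      ιΩ.comp (algebraMap K (MvPolynomial (Params n) K)) := IsScalarTower.algebraMap_eq _ _ _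
  -- `Λ = spec λ ≠ 0`
  have hΛ0 : spec (fun e => f.coeff e) (lam n d) ≠ 0 := spec_lam_ne_zero hf0 hfd
  have hΛF : ιF (spec (fun e => f.coeff e) (lam n d)) ≠ 0 := (map_ne_zero_iff ιF hιF_inj).2 hΛ0
  -- the specialised plane section `φ` over `𝔼` and its shape
  set fE : MvPolynomial (Fin n) (MvPolynomial (Params n) K) :=
    MvPolynomial.map (algebraMap K (MvPolynomial (Params n) K)) f with hfE
  have hfE_deg : fE.totalDegree = d := by
    rw [hfE, totalDegree_map_of_injective' f (algebraMap K (MvPolynomial (Params n) K)).injective, hfd]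
  set φ : Polynomial (Polynomial (MvPolynomial (Params n) K)) := MvPolynomial.aeval (fun i ↦
      (Polynomial.C (Polynomial.C (X (Sum.inr (Sum.inl i)))) +
        Polynomial.C (Polynomial.C (X (Sum.inr (Sum.inr i)))) * Polynomial.X +
        Polynomial.C (Polynomial.C (X (Sum.inl i)) * Polynomial.X) :
          Polynomial (Polynomial (MvPolynomial (Params n) K)))) f with hφ_def
  have hφE : φ = MvPolynomial.aeval (fun i ↦
      (Polynomial.C (Polynomial.C (X (Sum.inr (Sum.inl i)))) +
        Polynomial.C (Polynomial.C (X (Sum.inr (Sum.inr i)))) * Polynomial.X +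
        Polynomial.C (Polynomial.C (X (Sum.inl i)) * Polynomial.X) :
          Polynomial (Polynomial (MvPolynomial (Params n) K)))) fE := by
    rw [hφ_def, hfE, MvPolynomial.aeval_map_algebraMap]
  have hφcoeff : ∀ i j, (φ.coeff i).coeff j = spec (fun e => f.coeff e) (bivCoeff n d (i, j)) :=
    coeff_coeff_planeK f hf
  have hφtop : φ.coeff d = Polynomial.C (spec (fun e => f.coeff e) (lam n d)) := by
    rw [hφE, ← hfE_deg, coeff_planeConst_totalDegree, hfE_deg, hfE, homogeneousComponent_map,
      eval_map, ← MvPolynomial.aeval_def, ← spec_lam]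
  have hφdeg : φ.natDegree = d := by
    refine le_antisymm ?_ (Polynomial.le_natDegree_of_ne_zero ?_)
    · rw [hφE, ← hfE_deg]; exact natDegree_planeConst_le _ _ _ fE
    · rw [hφtop]; exact Polynomial.C_ne_zero.2 hΛ0
  have hφlc : φ.leadingCoeff = Polynomial.C (spec (fun e => f.coeff e) (lam n d)) := by
    rw [Polynomial.leadingCoeff, hφdeg, hφtop]
  have hφzero : ∀ i j, d < i + j → (φ.coeff i).coeff j = 0 := fun i j h => by
    rw [hφE]; exact coeff_coeff_planeConst_eq_zero _ _ _ fE i j (by rw [hfE_deg]; omega)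
  -- the line section `g = φ(x, 0)` and its discriminant `spec ρ̄`
  set g : Polynomial (MvPolynomial (Params n) K) := MvPolynomial.aeval (fun i ↦
      Polynomial.C (X (Sum.inr (Sum.inl i))) + Polynomial.C (X (Sum.inr (Sum.inr i))) * Polynomial.X :
        Fin n → Polynomial (MvPolynomial (Params n) K)) f with hg_def
  have hφg : φ.map (Polynomial.evalRingHom 0) = g := by
    rw [hφE, map_evalRingHom_zero_planeConst, hfE, MvPolynomial.aeval_map_algebraMap]
  have hres : Polynomial.resultant g (Polynomial.derivative g) d (d - 1) =
      spec (fun e => f.coeff e) (rhoBar n d) := (spec_rhoBar f hf).symm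
  have hgdeg : g.natDegree ≤ d := by
    rw [← hφg]; exact Polynomial.natDegree_map_le.trans hφdeg.le
  -- `ψ = φ/Λ` over `𝔽`
  set φF : Polynomial (Polynomial (FractionRing (MvPolynomial (Params n) K))) :=
    φ.map (Polynomial.mapRingHom ιF) with hφF
  set ψ : Polynomial (Polynomial (FractionRing (MvPolynomial (Params n) K))) :=
    Polynomial.C (Polynomial.C (ιF (spec (fun e => f.coeff e) (lam n d)))⁻¹) * φF with hψ
  have hmapinj : Function.Injective (Polynomial.mapRingHom ιF) := Polynomial.map_injective ιF hιF_inj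
  have hφF_deg : φF.natDegree = d := by
    rw [hφF, Polynomial.natDegree_map_eq_of_injective hmapinj, hφdeg]
  have hφF_lc : φF.leadingCoeff = Polynomial.C (ιF (spec (fun e => f.coeff e) (lam n d))) := by
    rw [hφF, Polynomial.leadingCoeff_map_of_injective hmapinj, hφlc, Polynomial.coe_mapRingHom,
      Polynomial.map_C]
  have hψ_monic : ψ.Monic := Polynomial.monic_C_mul_of_mul_leadingCoeff_eq_one (by
    rw [hφF_lc, ← Polynomial.C_mul, inv_mul_cancel₀ hΛF, Polynomial.C_1])
  have hψ_deg : ψ.natDegree = d := by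
    rw [hψ, Polynomial.natDegree_C_mul (Polynomial.C_ne_zero.2 (inv_ne_zero hΛF)), hφF_deg]
  have hψ_coeff : ∀ i j, (ψ.coeff i).coeff j =
      (ιF (spec (fun e => f.coeff e) (lam n d)))⁻¹ * ιF ((φ.coeff i).coeff j) := by
    intro i j
    rw [hψ, Polynomial.coeff_C_mul, Polynomial.coeff_C_mul, hφF, Polynomial.coeff_map,
      Polynomial.coe_mapRingHom, Polynomial.coeff_map]
  have hψ_zero : ∀ i j, d < i + j → (ψ.coeff i).coeff j = 0 := fun i j h => by
    rw [hψ_coeff, hφzero i j h, map_zero, mul_zero]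
  have hcomm : (Polynomial.evalRingHom (0 : FractionRing (MvPolynomial (Params n) K))).comp
      (Polynomial.mapRingHom ιF) = ιF.comp (Polynomial.evalRingHom 0) := by
    refine Polynomial.ringHom_ext (fun a => ?_) ?_ <;> simp
  have hψ_res : Polynomial.resultant (ψ.map (Polynomial.evalRingHom 0))
      (Polynomial.derivative (ψ.map (Polynomial.evalRingHom 0))) d (d - 1) ≠ 0 := by
    have h1 : ψ.map (Polynomial.evalRingHom 0) =
        Polynomial.C (ιF (spec (fun e => f.coeff e) (lam n d)))⁻¹ * g.map ιF := by
      rw [hψ, Polynomial.map_mul, Polynomial.map_C, Polynomial.coe_evalRingHom, Polynomial.eval_C, hφF,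
        Polynomial.map_map, hcomm, ← Polynomial.map_map, hφg]
    rw [h1, Polynomial.derivative_C_mul, Polynomial.resultant_C_mul_left, Polynomial.resultant_C_mul_right,
      Polynomial.derivative_map, Polynomial.resultant_map_map, hres]
    exact mul_ne_zero (pow_ne_zero _ (inv_ne_zero hΛF))
      (mul_ne_zero (pow_ne_zero _ (inv_ne_zero hΛF)) ((map_ne_zero_iff ιF hιF_inj).2 hρ))
  -- the engine, applied to `ψ`
  have heng := hengine (FractionRing (MvPolynomial (Params n) K)) ψ hψ_monic hψ_deg hψ_zero hψ_res
  -- coefficients of `ψ` versus the cleared evaluations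
  have hcoeffs : (fun b : ℕ × ℕ => (ψ.coeff b.1).coeff b.2) = fun b =>
      ιF (spec (fun e => f.coeff e) (bivCoeff n d b)) / ιF (spec (fun e => f.coeff e) (lam n d)) := by
    funext b
    rw [hψ_coeff, hφcoeff, div_eq_inv_mul]
  have hclear : ∀ s, spec (fun e => f.coeff e) (clearedEval n d D (Δ s)) = 0 ↔
      MvPolynomial.eval₂ (Int.castRingHom _) (fun b : ℕ × ℕ => (ψ.coeff b.1).coeff b.2) (Δ s) = 0 := by
    intro s
    rw [← map_eq_zero_iff ιF hιF_inj, map_spec_clearedEval ιF (fun e => f.coeff e) (Δ s) (hΔ s) hΛF,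
      hcoeffs, mul_eq_zero, or_iff_right (pow_ne_zero _ hΛF)]
  -- `ψ` over `Ω̄` is a unit multiple of the section of Lemma 7
  have hsecΩ : φ.map (Polynomial.mapRingHom ιΩ) = MvPolynomial.aeval (fun i ↦
      (Polynomial.C (Polynomial.C (ιΩ (X (Sum.inr (Sum.inl i))))) +
        Polynomial.C (Polynomial.C (ιΩ (X (Sum.inr (Sum.inr i))))) * Polynomial.X +
        Polynomial.C (Polynomial.C (ιΩ (X (Sum.inl i))) * Polynomial.X) :
          Polynomial (Polynomial (AlgebraicClosure (FractionRing (MvPolynomial (Params n) K)))))) f := by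
    rw [hφE, map_mapRingHom_planeConst, hfE, MvPolynomial.map_map, ← hKΩ, MvPolynomial.aeval_map_algebraMap]
  have hψΩ : ψ.map (Polynomial.mapRingHom jΩ) =
      Polynomial.C (Polynomial.C (jΩ (ιF (spec (fun e => f.coeff e) (lam n d)))⁻¹)) *
        MvPolynomial.aeval (fun i ↦
          (Polynomial.C (Polynomial.C (ιΩ (X (Sum.inr (Sum.inl i))))) +
            Polynomial.C (Polynomial.C (ιΩ (X (Sum.inr (Sum.inr i))))) * Polynomial.X +
            Polynomial.C (Polynomial.C (ιΩ (X (Sum.inl i))) * Polynomial.X) :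
              Polynomial (Polynomial (AlgebraicClosure (FractionRing (MvPolynomial (Params n) K)))))) f := by
    rw [hψ, Polynomial.map_mul, Polynomial.map_C, Polynomial.coe_mapRingHom, Polynomial.map_C, ← hsecΩ,
      hφF, Polynomial.map_map, hιΩ_eq]
    congr 2
    refine Polynomial.ringHom_ext (fun a => ?_) ?_ <;> simp
  have hunit : IsUnit (Polynomial.C (Polynomial.C (jΩ (ιF (spec (fun e => f.coeff e) (lam n d)))⁻¹)) :
      Polynomial (Polynomial (AlgebraicClosure (FractionRing (MvPolynomial (Params n) K))))) :=
    (((Ne.isUnit (inv_ne_zero hΛF)).map jΩ).map Polynomial.C).map Polynomial.C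
  have hirr_iff : Irreducible (ψ.map (Polynomial.mapRingHom jΩ)) ↔ Irreducible (MvPolynomial.aeval (fun i ↦
      (Polynomial.C (Polynomial.C (ιΩ (X (Sum.inr (Sum.inl i))))) +
        Polynomial.C (Polynomial.C (ιΩ (X (Sum.inr (Sum.inr i))))) * Polynomial.X +
        Polynomial.C (Polynomial.C (ιΩ (X (Sum.inl i))) * Polynomial.X) :
          Polynomial (Polynomial (AlgebraicClosure (FractionRing (MvPolynomial (Params n) K)))))) f) := by
    rw [hψΩ, irreducible_isUnit_mul hunit]
  -- algebraic independence of the parameters; the genericity hypotheses of Lemma 7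
  have hind : AlgebraicIndependent K (Sum.elim (fun i => ιΩ (X (Sum.inl i)))
      (Sum.elim (fun i => ιΩ (X (Sum.inr (Sum.inl i)))) (fun i => ιΩ (X (Sum.inr (Sum.inr i)))))) := by
    have h1 : (Sum.elim (fun i => ιΩ (X (Sum.inl i)))
        (Sum.elim (fun i => ιΩ (X (Sum.inr (Sum.inl i)))) (fun i => ιΩ (X (Sum.inr (Sum.inr i)))))) =
        fun p : Params n => ιΩ (X p) := by
      funext p; rcases p with i | i | i <;> rfl
    rw [h1]
    change Function.Injective (MvPolynomial.aeval (fun p : Params n => ιΩ (X p)))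
    have h2 : (MvPolynomial.aeval (fun p : Params n => ιΩ (X p)) :
        MvPolynomial (Params n) K →ₐ[K] AlgebraicClosure (FractionRing (MvPolynomial (Params n) K))) =
        IsScalarTower.toAlgHom K (MvPolynomial (Params n) K) _ := by
      rw [MvPolynomial.aeval_unique (IsScalarTower.toAlgHom K (MvPolynomial (Params n) K) _)]
      rfl
    rw [h2]
    exact hιΩ_inj
  have haevalΩ : ∀ p : MvPolynomial (Fin n) K,
      MvPolynomial.aeval (fun i => ιΩ (X (Sum.inr (Sum.inr i)))) p =
        ιΩ (MvPolynomial.aeval (fun i => (X (Sum.inr (Sum.inr i)) : MvPolynomial (Params n) K)) p) := by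
    intro p
    rw [MvPolynomial.map_aeval, ← hKΩ, MvPolynomial.aeval_def]
    rfl
  have hvtop : MvPolynomial.aeval (fun i => ιΩ (X (Sum.inr (Sum.inr i)))) (homogeneousComponent f.totalDegree f)
      ≠ 0 := by
    rw [hfd, haevalΩ, ← spec_lam]
    exact (map_ne_zero_iff ιΩ hιΩ_inj).2 hΛ0
  have hgΩ : g.map ιΩ = MvPolynomial.aeval (fun i => Polynomial.C (ιΩ (X (Sum.inr (Sum.inl i)))) +
      Polynomial.C (ιΩ (X (Sum.inr (Sum.inr i)))) * Polynomial.X :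
        Fin n → (AlgebraicClosure (FractionRing (MvPolynomial (Params n) K)))[X]) f := by
    have key : (Polynomial.mapRingHom ιΩ).comp (MvPolynomial.aeval (R := K) (fun i ↦
        Polynomial.C (X (Sum.inr (Sum.inl i))) + Polynomial.C (X (Sum.inr (Sum.inr i))) * Polynomial.X :
          Fin n → Polynomial (MvPolynomial (Params n) K))).toRingHom =
        (MvPolynomial.aeval (R := K) (fun i => Polynomial.C (ιΩ (X (Sum.inr (Sum.inl i)))) +
          Polynomial.C (ιΩ (X (Sum.inr (Sum.inr i)))) * Polynomial.X :
            Fin n → (AlgebraicClosure (FractionRing (MvPolynomial (Params n) K)))[X])).toRingHom := by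
      refine MvPolynomial.ringHom_ext (fun a => ?_) (fun i => ?_)
      · simp only [AlgHom.toRingHom_eq_coe, RingHom.coe_comp, RingHom.coe_coe, Function.comp_apply,
          MvPolynomial.algHom_C, Polynomial.algebraMap_apply, Polynomial.coe_mapRingHom, Polynomial.map_C,
          hKΩ]
      · simp only [AlgHom.toRingHom_eq_coe, RingHom.coe_comp, RingHom.coe_coe, Function.comp_apply,
          MvPolynomial.aeval_X, Polynomial.coe_mapRingHom, Polynomial.map_add, Polynomial.map_mul,
          Polynomial.map_C, Polynomial.map_X]
    rw [hg_def]
    exact DFunLike.congr_fun key f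
  have hsep : (MvPolynomial.aeval (fun i => Polynomial.C (ιΩ (X (Sum.inr (Sum.inl i)))) +
      Polynomial.C (ιΩ (X (Sum.inr (Sum.inr i)))) * Polynomial.X :
        Fin n → (AlgebraicClosure (FractionRing (MvPolynomial (Params n) K)))[X]) f).Separable := by
    rw [← hgΩ, Polynomial.separable_def]
    have hgΩdeg : (g.map ιΩ).natDegree ≤ d := Polynomial.natDegree_map_le.trans hgdeg
    have hgΩ'deg : (Polynomial.derivative (g.map ιΩ)).natDegree ≤ d - 1 :=
      (Polynomial.natDegree_derivative_le _).trans (Nat.sub_le_sub_right hgΩdeg 1)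
    obtain ⟨p₁, p₂, -, -, hpq⟩ := Polynomial.exists_mul_add_mul_eq_C_resultant (g.map ιΩ)
      (Polynomial.derivative (g.map ιΩ)) hgΩdeg hgΩ'deg (Or.inl (by omega))
    have hr : (g.map ιΩ).resultant (Polynomial.derivative (g.map ιΩ)) d (d - 1) =
        ιΩ (spec (fun e => f.coeff e) (rhoBar n d)) := by
      rw [Polynomial.derivative_map, Polynomial.resultant_map_map, hres]
    rw [hr] at hpq
    have hr0 : ιΩ (spec (fun e => f.coeff e) (rhoBar n d)) ≠ 0 := (map_ne_zero_iff ιΩ hιΩ_inj).2 hρ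
    refine ⟨Polynomial.C (ιΩ (spec (fun e => f.coeff e) (rhoBar n d)))⁻¹ * p₁,
      Polynomial.C (ιΩ (spec (fun e => f.coeff e) (rhoBar n d)))⁻¹ * p₂, ?_⟩
    calc Polynomial.C (ιΩ (spec (fun e => f.coeff e) (rhoBar n d)))⁻¹ * p₁ * g.map ιΩ +
        Polynomial.C (ιΩ (spec (fun e => f.coeff e) (rhoBar n d)))⁻¹ * p₂ * Polynomial.derivative (g.map ιΩ)
        = Polynomial.C (ιΩ (spec (fun e => f.coeff e) (rhoBar n d)))⁻¹ *
            (g.map ιΩ * p₁ + Polynomial.derivative (g.map ιΩ) * p₂) := by ring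
      _ = 1 := by rw [hpq, ← Polynomial.C_mul, inv_mul_cancel₀ hr0, Polynomial.C_1]
  have hL7 : IsAbsIrreducible f → Irreducible (MvPolynomial.aeval (fun i ↦
      (Polynomial.C (Polynomial.C (ιΩ (X (Sum.inr (Sum.inl i))))) +
        Polynomial.C (Polynomial.C (ιΩ (X (Sum.inr (Sum.inr i))))) * Polynomial.X +
        Polynomial.C (Polynomial.C (ιΩ (X (Sum.inl i))) * Polynomial.X) :
          Polynomial (Polynomial (AlgebraicClosure (FractionRing (MvPolynomial (Params n) K)))))) f) :=
    fun habs => irreducible_planeSection_of_algebraicIndependent habs _ _ _ hind hvtop hsep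
  -- conclusion
  constructor
  · intro hall habs
    exact heng.1 (fun s => (hclear s).1 (hall s)) (hirr_iff.2 (hL7 habs))
  · intro hnabs s
    rw [hclear]
    refine heng.2 ?_ s
    rw [hirr_iff]
    -- a factorisation of `f` over `K̄` gives one of the section over `Ω̄`
    have hfK : ¬ Irreducible (MvPolynomial.map (algebraMap K (AlgebraicClosure K)) f) := hnabs
    have hfK0 : MvPolynomial.map (algebraMap K (AlgebraicClosure K)) f ≠ 0 := by
      intro h; exact hf0 (MvPolynomial.map_injective _ (algebraMap K (AlgebraicClosure K)).injective
        (by rw [h, map_zero]))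
    have hfKdeg : (MvPolynomial.map (algebraMap K (AlgebraicClosure K)) f).totalDegree = d := by
      rw [totalDegree_map_of_injective' f (algebraMap K (AlgebraicClosure K)).injective, hfd]
    have hposdeg : ∀ {L : Type u} [Field L] {a : MvPolynomial (Fin n) L}, a ≠ 0 → ¬ IsUnit a →
        0 < a.totalDegree := by
      intro L _ a ha0 hau
      by_contra h
      have h0 : a.totalDegree = 0 := by omega
      apply hau
      rw [MvPolynomial.isUnit_iff_totalDegree_of_isReduced]
      refine ⟨Ne.isUnit ?_, h0⟩
      intro hc
      apply ha0
      rw [totalDegree_eq_zero_iff_eq_C] at h0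
      rw [h0, hc, C_0]
    have hfKu : ¬ IsUnit (MvPolynomial.map (algebraMap K (AlgebraicClosure K)) f) := by
      intro hu
      have := (MvPolynomial.isUnit_iff_totalDegree_of_isReduced.1 hu).2
      omega
    obtain ⟨a, b, hab, ha, hb⟩ : ∃ a b, MvPolynomial.map (algebraMap K (AlgebraicClosure K)) f = a * b ∧
        ¬ IsUnit a ∧ ¬ IsUnit b := by
      by_contra hno
      push Not at hno
      exact hfK ⟨hfKu, fun a b h => (or_iff_not_imp_left.2 (hno a b h))⟩
    have ha0 : a ≠ 0 := fun h => hfK0 (by rw [hab, h, zero_mul])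
    have hb0 : b ≠ 0 := fun h => hfK0 (by rw [hab, h, mul_zero])
    -- transport to `Ω̄`
    let j : AlgebraicClosure K →ₐ[K] AlgebraicClosure (FractionRing (MvPolynomial (Params n) K)) :=
      IsAlgClosed.lift
    set jr : AlgebraicClosure K →+* AlgebraicClosure (FractionRing (MvPolynomial (Params n) K)) :=
      j.toRingHom with hjr_def
    have hjr : jr.comp (algebraMap K (AlgebraicClosure K)) = algebraMap K _ := j.comp_algebraMap
    have hjr_inj : Function.Injective jr := j.toRingHom.injective
    set fΩ : MvPolynomial (Fin n) (AlgebraicClosure (FractionRing (MvPolynomial (Params n) K))) :=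
      MvPolynomial.map (algebraMap K _) f with hfΩ_def
    have hfΩ : fΩ = MvPolynomial.map jr a * MvPolynomial.map jr b := by
      rw [← map_mul, ← hab, MvPolynomial.map_map, hjr]
    have hja : 0 < (MvPolynomial.map jr a).totalDegree := by
      rw [totalDegree_map_of_injective' a hjr_inj]; exact hposdeg ha0 ha
    have hjb : 0 < (MvPolynomial.map jr b).totalDegree := by
      rw [totalDegree_map_of_injective' b hjr_inj]; exact hposdeg hb0 hb
    have hfΩdeg : fΩ.totalDegree = d := by
      rw [hfΩ_def, totalDegree_map_of_injective' f (algebraMap K _).injective, hfd]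
    -- the section of `fΩ` has exact `x`-degree `d`
    have hsecdeg : (MvPolynomial.aeval (fun i ↦
        (Polynomial.C (Polynomial.C (ιΩ (X (Sum.inr (Sum.inl i))))) +
          Polynomial.C (Polynomial.C (ιΩ (X (Sum.inr (Sum.inr i))))) * Polynomial.X +
          Polynomial.C (Polynomial.C (ιΩ (X (Sum.inl i))) * Polynomial.X) :
            Polynomial (Polynomial (AlgebraicClosure (FractionRing (MvPolynomial (Params n) K)))))) fΩ).natDegree
        = fΩ.totalDegree := by
      refine le_antisymm (natDegree_planeConst_le _ _ _ fΩ) (Polynomial.le_natDegree_of_ne_zero ?_)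
      rw [coeff_planeConst_totalDegree, hfΩdeg, hfΩ_def, homogeneousComponent_map, eval_map,
        ← MvPolynomial.aeval_def, ← hfd]
      exact Polynomial.C_ne_zero.2 hvtop
    have hnot := not_irreducible_planeConst_of_mul _ _ _ hfΩ hja hjb hsecdeg
    rwa [hfΩ_def, MvPolynomial.aeval_map_algebraMap] at hnot


/-! ### The three cases together -/

/-- **Kaltofen's case analysis (relative to the engine).** For `f` of degree `≤ d` over a field:
(all top coefficients vanish) ∨ (`spec ρ̄ = 0`) ∨ (all `spec (λ^D Δ'_s) = 0`) iff
`deg f < d` or `f` is not absolutely irreducible. Case `S₁` is the degree, case `S₂` is Lemma 3,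
case `S₃` is `spec_clearedEval_eq_zero_iff`. [cite: Kaltofen1995, §5 proof of Thm. 7 (pp. 24–25)] -/
theorem vanishing_iff_of_engine (hd : 2 ≤ d) {ι : Type*} (Δ : ι → MvPolynomial (ℕ × ℕ) ℤ)
    {D : ℕ} (hΔ : ∀ s, (Δ s).totalDegree ≤ D)
    (hengine : ∀ (F : Type u) [Field F] (ψ : Polynomial (Polynomial F)),
      ψ.Monic → ψ.natDegree = d → (∀ i j, d < i + j → (ψ.coeff i).coeff j = 0) →
      Polynomial.resultant (ψ.map (Polynomial.evalRingHom 0))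
        (Polynomial.derivative (ψ.map (Polynomial.evalRingHom 0))) d (d - 1) ≠ 0 →
      ((∀ s, MvPolynomial.eval₂ (Int.castRingHom F) (fun b : ℕ × ℕ => (ψ.coeff b.1).coeff b.2) (Δ s) = 0) ↔
        ¬ Irreducible (ψ.map (Polynomial.mapRingHom (algebraMap F (AlgebraicClosure F))))))
    (f : MvPolynomial (Fin n) K) (hf : f.totalDegree ≤ d) :
    ((∀ e ∈ topExps n d, f.coeff e = 0) ∨ spec (fun e => f.coeff e) (rhoBar n d) = 0 ∨
        ∀ s, spec (fun e => f.coeff e) (clearedEval n d D (Δ s)) = 0) ↔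
      (f.totalDegree < d ∨ ¬ IsAbsIrreducible f) := by
  classical
  -- degree `< d` iff all top coefficients vanish
  have htop : (∀ e ∈ topExps n d, f.coeff e = 0) ↔ f.totalDegree < d := by
    constructor
    · intro h
      refine lt_of_le_of_ne hf fun hfd => ?_
      have hf0 : f ≠ 0 := by rintro rfl; rw [totalDegree_zero] at hfd; omega
      obtain ⟨e, he, hedeg⟩ := Finset.exists_mem_eq_sup f.support (support_nonempty.2 hf0)
        (fun s : Fin n →₀ ℕ => s.sum fun _ k => k)
      have hed : (e.sum fun _ k => k) = d := by rw [← hedeg, ← hfd]; rfl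
      exact (mem_support_iff.1 he) (h e (mem_topExps.2 hed))
    · intro h e he
      rw [mem_topExps] at he
      by_contra hne
      have := le_totalDegree (mem_support_iff.2 hne)
      omega
  by_cases hfd : f.totalDegree = d
  · -- degree exactly `d`
    have hnot : ¬ f.totalDegree < d := by omega
    rw [htop]
    by_cases hρ : spec (fun e => f.coeff e) (rhoBar n d) = 0
    · -- case `S₂`: Lemma 3
      simp only [hρ, true_or, or_true, true_iff]
      right
      intro habs
      have h3 := resultant_genericLine_derivative_ne_zero habs
      rw [hfd, ← spec_rhoBar f hf] at h3
      exact h3 hρ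
    · -- case `S₃`
      rw [spec_clearedEval_eq_zero_iff hd Δ hΔ hengine f hfd hρ]
      simp [hρ, hnot]
  · have hlt : f.totalDegree < d := lt_of_le_of_ne hf hfd
    simp only [hlt, true_or, iff_true]
    exact Or.inl (htop.2 hlt)

/-- **From the product forms `Φ = c_e σ τ` to the three cases** (Kaltofen: "If one of the
resulting values in `K` is not zero, we conclude … Now suppose that all forms vanish"): over a
domain, all products `q_e · σ(q) · τ(q)` over `e ∈ S₁`, `σ ∈ S(ρ̄)`, `τ ∈ S(λ^D Δ'_s)` vanish
iff one of the three factor families vanishes identically. [cite: Kaltofen1995, §5 proof of Thm. 7 (p. 25)] -/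
theorem forall_prod_eq_zero_iff {R : Type*} [CommRing R] [IsDomain R] {α β γ : Type*}
    (A : Finset α) (B : Finset β) (Cs : Finset γ) (a : α → R) (b : β → R) (c : γ → R) :
    (∀ x ∈ A, ∀ y ∈ B, ∀ z ∈ Cs, a x * b y * c z = 0) ↔
      ((∀ x ∈ A, a x = 0) ∨ (∀ y ∈ B, b y = 0) ∨ ∀ z ∈ Cs, c z = 0) := by
  constructor
  · intro h
    by_contra hno
    push Not at hno
    obtain ⟨⟨x, hx, hax⟩, ⟨y, hy, hby⟩, ⟨z, hz, hcz⟩⟩ := hno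
    have := h x hx y hy z hz
    rcases mul_eq_zero.1 this with h1 | h1
    · rcases mul_eq_zero.1 h1 with h2 | h2
      · exact hax h2
      · exact hby h2
    · exact hcz h1
  · rintro (h | h | h) x hx y hy z hz
    · rw [h x hx, zero_mul, zero_mul]
    · rw [h y hy, mul_zero, zero_mul]
    · rw [h z hz, mul_zero]

end Specialised

end KaltofenGeneric

end Literature.RingTheory.MvPolynomial

end
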